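import Summits.HodgeConjecture.HodgeConjecture.Theorems.Ring2DeformQbarHodgeFamilies
import Literature.AlgebraicGeometry.Motives.AbelianFibresOfAbelianFibre
import HarnessLib

/-!
# Ring 2 · route `deform`, XVI-c — the residual clause R of part XVI-b SPLIT: its complex half "every complex fibre of the
# family through `A` is an abelian variety of dimension `dim A`" is ONE THEOREM IN PRINT (Catanese: "a deformation in the
# large of complex tori is a complex torus"), recorded as a CITED NAMED FACT on the tree's carriers; the binder `hE` of part
# XVI is thereby discharged to named print facts modulo ONE descent clause at `ℚ̄`-points (`QbarFibreDescent`)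

HONEST FRAMING: research route conditional on HC_CM; not a corollary; Q11.4-sentence-2 already refuted in dim ≥ 3.

WHAT THIS PART DOES (and does not). Part XVI-b proved `hE = QbarHodgeFamilies` from Voisin's `ℚ̄`-spread of an absolute
Hodge class (`hVo`), Deligne's partie fixe (`hD`) and "Hodge classes on abelian varieties are absolute" (`hDel`) modulo
the residual `R = QbarAbelianFibres` = (i) ∧ (ii): (i) all complex fibres of the spread family are abelian varieties of
dimension `dim A`; (ii) its fibres over the `ℚ̄`-locus are complexifications of abelian varieties over `ℚ^al ⊂ ℂ`. Here:
* §A `catanese2002_abelianFibres_of_abelianFibre` — clause (i) ALONE, a statement about ONE complex family with no `ℚ̄`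
  in it, is a published theorem: Catanese 2002, Thm. 4.1 *"Every deformation of a complex torus of dimension `n` is a
  complex torus of dimension `n`"*, Thm. 4.6 *"A deformation in the large of complex tori is a complex torus"*, read on
  the tree's carriers through a textbook dictionary (irreducible ⟹ `S(ℂ)` connected; Ehresmann; projective complex torus
  = abelian variety, Chow/GAGA), each step cited there. It is the tree's NAMED FACT
  `Literature.AlgebraicGeometry.Motives.catanese2002_abelianFibres_of_abelianFibre` (D-0014: a `[cite]`d `Prop`, a
  hypothesis BY NAME, never asserted; `Literature/AlgebraicGeometry/Motives/AbelianFibresOfAbelianFibre.lean`).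
  Mumford's [MumfordGIT, Thm. 6.14] is the algebraic, sectioned form of the same statement (XVI-b's docstring of R cited
  it through étale-local sections).
* §B `QbarFibreDescent` (R′) — what is LEFT of R once (i) is a fact: a descent statement at ONE point of the `ℚ̄`-locus
  with the abelian chart now a HYPOTHESIS. Theorem in print (transitivity of base change + para-abelian descent over the
  algebraically closed `ℚ̄` + transport along `σ : ℚ̄ ≅ ℚ^al`), OPEN in Lean on these carriers when this part landed
  (2026-08-20) and PROVED in Lean since 2026-08-21 (`qbarFibreDescent_holds`, part XVI-e; REVISION 2 below);
  `@[conjecture]` (tag kept — a tree line), consumed BY NAME. R′ is not R renamed: no smoothness, irreducibility,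
  relative dimension or abelian fibre ELSEWHERE is assumed.
* §C KERNEL PROOFS: `R ⟸ §A ∧ R′` (`qbarAbelianFibres_of_abelianFibres_of_qbarFibreDescent`); hence `hE` from
  [hVo, hD, hDel, hCat; R′]; the rows of XVI-b re-based on those binders (documentary concordance: the LEAD's ledger
  counts the discharge of (i) ONCE, here, by the print fact — the same fact serves the transport axis' `AbelianFibres`).

REVISION 2 (2026-08-21; DOCSTRING-ONLY — every statement and proof below is byte-identical to rev. 1, p204657).
R′ = `QbarFibreDescent` is now a THEOREM OF THE KERNEL with no hypothesis: `qbarFibreDescent_holds` (part XVI-e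
`Ring2DeformQbarFibreDescentHolds`, seat ring2-b01, p300410), namely part XVI-d's `qbarFibreDescent_of_paraAbelianDescent`
applied to the Literature THEOREM `LaurentSchroer2023.groupLaw_of_isParaAbelian_of_point_holds (AlgebraicClosure ℚ)`
(`Literature/AlgebraicGeometry/LaurentSchroer2023/ParaAbelianGroupLawHolds.lean`, p299204: Laurent–Schröer Prop. 4.3
for `S = Spec k`, `k` ALGEBRAICALLY CLOSED, proved by spreading the group law out to a finitely generated `k`-subalgebra
(EGA IV₃ 8.8.2) and specialising at a `k`-point; the printed generality — an arbitrary ground field, fpqc descent of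
the group law — is NOT discharged and is not consumed on this axis). Consequences for THIS file: the node of §B keeps
its `@[conjecture]` tag and its statement (tree lines; still consumed BY NAME as `hDesc` below) but its status is
CLOSED; R = `QbarAbelianFibres` follows from Catanese's fact ALONE (`qbarAbelianFibres_of_abelianFibres_of_
qbarFibreDescent hCat qbarFibreDescent_holds`); `hE` and every row of §C hold modulo the FOUR named print facts
{`hVo`, `hD`, `hDel`, `hCat`} (+ `hJ` on the arithmetic axis), stated `hDesc`-free in XVI-e under the names
`…_of_fourPrintFacts`. Count once: the discharge and XVI-e are ring2-b01's; nothing of this file is re-proved there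
or here. [cite: LaurentSchroer2023, §4 Prop. 4.3 (case S = Spec k, k algebraically closed)] [cite: EGAIV3, Thm. 8.8.2]

HONEST COLUMN. (1) PROVED here: the split and the re-based rows, kernel-checked, every hypothesis BY NAME. (2) IN PRINT,
hypothesis in Lean: §A — a theorem about compact complex manifolds; in Lean it can only fail by a carrier mismatch.
(3) R′: theorem in print; OPEN in Lean at rev. 1 (2026-08-20); a THEOREM OF THE KERNEL since 2026-08-21
(`qbarFibreDescent_holds`, part XVI-e — REVISION 2 above). (4) UNCHANGED and OPEN: Q (`QbarSpreading`, the KIND-2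
reading of XVI), `HC_QbarAV`, `HC_CM`, `L(𝔇)`; stmt-HodgeConjecture-16267 stays OPEN; nothing here is a case of HC
and no converse `R′ ⟸ hE` is claimed. (5) New mathematics: none — the value is that the residual of `hE` was cut to
ONE descent clause at a `ℚ̄`-point, the rest being four named print facts, with the assembly kernel-checked; since
XVI-e there is NO residual: `hE` modulo the four named print facts only.
-/

set_option linter.dupNamespace false

namespace Summit.HodgeConjecture.HodgeConjecture.Ring2.Deform

open CategoryTheory AlgebraicGeometry
open Literature.AlgebraicGeometry Literature.AlgebraicGeometry.Motives
open Literature.AlgebraicGeometry.HodgeTheory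
open Summit.HodgeConjecture.HodgeConjecture
open Summit.HodgeConjecture.HodgeConjecture.Theses
open Summit.HodgeConjecture.HodgeConjecture.Theses.RankFourFaces (CMAbelianHodge CMToAbelian)
open Summit.HodgeConjecture.HodgeConjecture.Theses.PadicSemiregularLift (HodgeAbelianVarieties)
open Summit.HodgeConjecture.HodgeConjecture.Ring2.AbelianAll (ClosesWithCM ExactWithCM ModCM PivotAV)

/-! ## §A The print fact (imported): `catanese2002_abelianFibres_of_abelianFibre`

Clause (i) of R is the Literature fact `catanese2002_abelianFibres_of_abelianFibre` (Catanese 2002 Thm. 4.1/4.6 on the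
carriers `IsSmoothProjectiveFamily` / `fiberOver` / `AbelianVariety`: for `f : 𝒳 ⟶ S` a smooth projective family of
relative dimension `dim A` between quasi-projective `ℂ`-schemes over an irreducible smooth `S` with ONE complex fibre
`≅ A.X`, every complex fibre is `≅ A'.X` for a complex abelian variety `A'` of dimension `dim A`). It enters below only
as the binder `hCat`. -/

/-! ## §B The residual node R′: descent of an abelian fibre over a point of the `ℚ̄`-locus
(CLOSED since 2026-08-21: `qbarFibreDescent_holds`, part XVI-e — see REVISION 2 in the module docstring) -/

/-- **`QbarFibreDescent` (R′) — an abelian complex fibre over a `ℚ̄`-point of a `ℚ̄`-family is the complexification of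
an abelian variety over `ℚ^al` (THEOREM IN PRINT; at rev. 1 an OPEN hypothesis in Lean and the ONLY residual of part
XVI's binder `hE` after §C; since 2026-08-21 a THEOREM OF THE KERNEL — `qbarFibreDescent_holds`, part XVI-e
`Ring2DeformQbarFibreDescentHolds` (ring2-b01), from part XVI-d at the Literature theorem
`LaurentSchroer2023.groupLaw_of_isParaAbelian_of_point_holds (AlgebraicClosure ℚ)` — so `hE` has NO residual beyond
four named print facts).** For `σ : ℚ̄ →+* ℂ`, a morphism `f₀ : 𝒳₀ ⟶ S₀` of quasi-projective `ℚ̄`-schemes, a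
complex point `t` of `S₀ ⊗_σ ℂ` in the `ℚ̄`-locus (`qbarLocus`: `t` lies over a CLOSED point `x ∈ S₀`) and a complex
abelian variety `A'` with `A'.X ≅ 𝒳_t := (f₀ ⊗_σ ℂ)⁻¹(t)`: there is an abelian variety `A₀` over `ℚ^al =` the
algebraic closure of `ℚ` in `ℂ` (part V's carrier of `HC_QbarAV`) with `dim A₀ = dim A'` and `A₀ ⊗ ℂ ≅ 𝒳_t`. Print:
`κ(x) = ℚ̄` (Nullstellensatz [Hartshorne1977, Ch. II Ex. 3.14]); `𝒳_t ≅ (𝒳₀)_x ⊗_{ℚ̄,σ} ℂ` (transitivity of fibre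
products [GortzWedhorn2020, §(4.7) after Prop. 4.16 and §(4.8) Def. 4.25]); hence the proper `ℚ̄`-scheme `(𝒳₀)_x` is
PARA-ABELIAN — *"a para-abelian variety if there is a field extension `k ⊂ k'` such that the base-change
`P' = P ⊗_k k'` admits the structure of an abelian variety"* — and, `ℚ̄` being algebraically closed, has a rational
point `e`, so *"there is a unique group law … that turns `P → S` into a family of abelian varieties, with `e` as the
zero section"* (case `S = Spec k`) [LaurentSchroer2023, §4 (definition) and Prop. 4.3]; equivalently the group law of
`A'` spreads over a finitely generated `ℚ̄`-subalgebra of `ℂ` and specialises at a `ℚ̄`-point [EGAIV3, Thm. 8.8.2 and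
Thm. 8.10.5]; transport along the isomorphism `σ : ℚ̄ ≅ ℚ^al ⊂ ℂ` onto its image; dimension is invariant under
extension of the base field.
NOT R renamed (hypotheses of ONE fibre only; conclusion = R's clause (ii) at that fibre); NOT a case of HC; NOT
asserted; the binder `hDesc` of §C (dischargeable by the one term `qbarFibreDescent_holds` since XVI-e; the tag
`@[conjecture]` is kept because the declaration line is a tree line — the node is CLOSED, not open).
[cite: LaurentSchroer2023, §4 (definition of para-abelian) and Prop. 4.3]
[cite: GortzWedhorn2020, §(4.7)–(4.8), Prop. 4.16 and Def. 4.25] [cite: EGAIV3, Thm. 8.8.2 and Thm. 8.10.5]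
[cite: Hartshorne1977, Ch. II Ex. 3.14]
[status: proved 2026-08-21 — `qbarFibreDescent_holds`, `Theorems/Ring2DeformQbarFibreDescentHolds.lean` (p300410)] -/
@[conjecture] def QbarFibreDescent : Prop :=
  ∀ (σ : AlgebraicClosure ℚ →+* ℂ) ⦃𝒳₀ S₀ : SchemeOver (AlgebraicClosure ℚ)⦄ (f₀ : 𝒳₀ ⟶ S₀),
    IsQuasiProjectiveOver 𝒳₀ → IsQuasiProjectiveOver S₀ →
    ∀ t ∈ qbarLocus σ S₀, ∀ (A' : AbelianVariety ℂ),
      Nonempty (A'.X ≅ fiberOver ((baseChangeHom σ).map f₀) t) →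
      ∃ A₀ : AbelianVariety (IntermediateField.toSubfield (algebraicClosure ℚ ℂ)),
        A₀.dim = A'.dim ∧ Nonempty ((A₀.baseChange ℂ).X ≅ fiberOver ((baseChangeHom σ).map f₀) t)

/-! ## §C R from the fact and R′; `hE` and the rows of XVI-b re-based -/

/-- **R ⟸ (Catanese's fact) ∧ R′.** Clause (i) of `QbarAbelianFibres` is the fact applied to the complexified family
`f₀ ⊗_σ ℂ` (quasi-projectivity passes to `⊗_σ ℂ`: `IsQuasiProjectiveOver.baseChangeHom`); clause (ii) at `t` in the
`ℚ̄`-locus is R′ applied to the abelian chart that (i) provides at `t`. Kernel proof, both hypotheses BY NAME.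
[cite: Catanese2002DeformationTypes, §4 Thm. 4.1 and Thm. 4.6] [cite: LaurentSchroer2023, §4 Prop. 4.3] -/
theorem qbarAbelianFibres_of_abelianFibres_of_qbarFibreDescent (hCat : catanese2002_abelianFibres_of_abelianFibre)
    (hDesc : QbarFibreDescent) : QbarAbelianFibres := by
  intro σ 𝒳₀ S₀ f₀ A h𝒳₀ hS₀ hirr hsm hf hs₁
  have hi : ∀ t : ComplexPoints ((baseChangeHom σ).obj S₀),
      ∃ A' : AbelianVariety ℂ, A'.dim = A.dim ∧ Nonempty (A'.X ≅ fiberOver ((baseChangeHom σ).map f₀) t) :=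
    hCat ((baseChangeHom σ).map f₀) A (h𝒳₀.baseChangeHom σ) (hS₀.baseChangeHom σ) hirr hsm hf hs₁
  refine ⟨hi, fun t ht ↦ ?_⟩
  obtain ⟨A', hA', ⟨e⟩⟩ := hi t
  obtain ⟨A₀, hA₀, ⟨e₀⟩⟩ := hDesc σ f₀ h𝒳₀ hS₀ t ht A' ⟨e⟩
  exact ⟨A₀, hA₀.trans hA', ⟨e₀⟩⟩

/-- **`hE = QbarHodgeFamilies` from FOUR named print facts modulo R′**: Voisin's `ℚ̄`-spread (`hVo`), the partie fixe
(`hD`), Deligne 1982 Thm. 2.11 (`hDel`), Catanese's abelian fibres (`hCat`); residual `hDesc = QbarFibreDescent`.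
(XVI-b `qbarHodgeFamilies_of_flatSpread` with its binder `hR` proved from `hCat ∧ hDesc`.)
[cite: Voisin2007HodgeLoci, §3 proof of Prop. 1.2, first paragraph (arXiv math/0605766 p. 6)]
[cite: Catanese2002DeformationTypes, §4 Thm. 4.1 and Thm. 4.6] -/
theorem qbarHodgeFamilies_of_flatSpread_of_qbarFibreDescent (hVo : voisin2007_flatSpread_of_isAbsoluteHodgeClass)
    (hD : deligne_globalInvariantCycles) (hDel : deligne1982_hodgeClasses_abelianVariety_absoluteHodge)
    (hCat : catanese2002_abelianFibres_of_abelianFibre) (hDesc : QbarFibreDescent) : QbarHodgeFamilies :=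
  qbarHodgeFamilies_of_flatSpread hVo hD hDel (qbarAbelianFibres_of_abelianFibres_of_qbarFibreDescent hCat hDesc)

/-- The same from the WEAKLY absolute spread (the form held by the bridge `QbarSummit`). [cite: Voisin2007HodgeLoci, Def. 2.1 and §3] -/
theorem qbarHodgeFamilies_of_weaklyAbsoluteFlatSpread_of_qbarFibreDescent
    (hWS : voisin2007_flatSpread_of_isWeaklyAbsoluteHodgeClass) (hD : deligne_globalInvariantCycles)
    (hDel : deligne1982_hodgeClasses_abelianVariety_absoluteHodge) (hCat : catanese2002_abelianFibres_of_abelianFibre)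
    (hDesc : QbarFibreDescent) : QbarHodgeFamilies :=
  qbarHodgeFamilies_of_flatSpread_of_qbarFibreDescent (flatSpread_of_isAbsoluteHodgeClass_of_isWeaklyAbsolute hWS)
    hD hDel hCat hDesc

/-- **EXACTNESS of row Q re-based**: `HC_AV ↔ HC_QbarAV ∧ Q` modulo [four named facts; R′].
[cite: Voisin2007HodgeLoci, §3 proof of Prop. 1.2 (p. 6)] [cite: Catanese2002DeformationTypes, §4 Thm. 4.1 and Thm. 4.6] -/
theorem HC_AV_iff_hodgeConjectureQbarAV_and_qbarSpreading_of_qbarFibreDescent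
    (hVo : voisin2007_flatSpread_of_isAbsoluteHodgeClass) (hD : deligne_globalInvariantCycles)
    (hDel : deligne1982_hodgeClasses_abelianVariety_absoluteHodge) (hCat : catanese2002_abelianFibres_of_abelianFibre)
    (hDesc : QbarFibreDescent) : HodgeAbelianVarieties ↔ HodgeConjectureQbarAV ∧ QbarSpreading :=
  HC_AV_iff_hodgeConjectureQbarAV_and_qbarSpreading (qbarHodgeFamilies_of_flatSpread_of_qbarFibreDescent hVo hD hDel hCat hDesc)

/-- In the LEAD's grid: `PivotAV (HC_QbarAV ∧ Q)` modulo [four named facts; R′] — `HC_CM`-free. [folklore] -/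
theorem pivotAV_qbarAV_and_qbarSpreading_of_qbarFibreDescent (hVo : voisin2007_flatSpread_of_isAbsoluteHodgeClass)
    (hD : deligne_globalInvariantCycles) (hDel : deligne1982_hodgeClasses_abelianVariety_absoluteHodge)
    (hCat : catanese2002_abelianFibres_of_abelianFibre) (hDesc : QbarFibreDescent) :
    PivotAV (HodgeConjectureQbarAV ∧ QbarSpreading) :=
  pivotAV_qbarAV_and_qbarSpreading (qbarHodgeFamilies_of_flatSpread_of_qbarFibreDescent hVo hD hDel hCat hDesc)

/-- **EXACTNESS on the arithmetic axis re-based**: `HC_AV ↔ HC_CM ∧ L(𝔇) ∧ Q` modulo [`hJ` = Milne 1999 Thm 7.1 + Deligne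
1982 2.9(b); four named facts; R′]. `HC_CM` is a hypothesis BY NAME and load-bearing. [cite: Milne1999, §7 Thm. 7.1]
[cite: Catanese2002DeformationTypes, §4 Thm. 4.1 and Thm. 4.6] -/
theorem HC_AV_iff_HC_CM_and_spanLifting_and_qbarSpreading_of_qbarFibreDescent (𝔇 : RealizationFamily)
    (hJ : CMAbelianHodge → SpecialisationsAlgebraicAV 𝔇) (hVo : voisin2007_flatSpread_of_isAbsoluteHodgeClass)
    (hD : deligne_globalInvariantCycles) (hDel : deligne1982_hodgeClasses_abelianVariety_absoluteHodge)
    (hCat : catanese2002_abelianFibres_of_abelianFibre) (hDesc : QbarFibreDescent) :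
    HodgeAbelianVarieties ↔ CMAbelianHodge ∧ (SpanLiftingAtAlmostAllPrimesAV 𝔇 ∧ QbarSpreading) :=
  HC_AV_iff_HC_CM_and_spanLifting_and_qbarSpreading 𝔇 hJ
    (qbarHodgeFamilies_of_flatSpread_of_qbarFibreDescent hVo hD hDel hCat hDesc)

/-- `ExactWithCM (L(𝔇) ∧ Q)` and `ClosesWithCM (L(𝔇) ∧ Q)` modulo [`hJ`; four named facts; R′]. [cite: Milne1999, §7 Thm. 7.1] -/
theorem exactWithCM_spanLifting_and_qbarSpreading_of_qbarFibreDescent (𝔇 : RealizationFamily)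
    (hJ : CMAbelianHodge → SpecialisationsAlgebraicAV 𝔇) (hVo : voisin2007_flatSpread_of_isAbsoluteHodgeClass)
    (hD : deligne_globalInvariantCycles) (hDel : deligne1982_hodgeClasses_abelianVariety_absoluteHodge)
    (hCat : catanese2002_abelianFibres_of_abelianFibre) (hDesc : QbarFibreDescent) :
    ExactWithCM (SpanLiftingAtAlmostAllPrimesAV 𝔇 ∧ QbarSpreading) ∧
      ClosesWithCM (SpanLiftingAtAlmostAllPrimesAV 𝔇 ∧ QbarSpreading) :=
  exactWithCM_spanLifting_and_qbarSpreading 𝔇 hJ (qbarHodgeFamilies_of_flatSpread_of_qbarFibreDescent hVo hD hDel hCat hDesc)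

/-- **THE ITEM EXACTLY, re-based**: `CMToAbelian ↔ ModCM (L(𝔇) ∧ Q)` — stmt-HodgeConjecture-16267 — now modulo [`hJ`;
Voisin's spread, the partie fixe, Deligne 2.11, Catanese's abelian fibres — named print facts; R′]. The item stays OPEN.
[cite: Milne1999, §7 Thm. 7.1] [cite: Voisin2007HodgeLoci, §3 (p. 6)] [cite: Catanese2002DeformationTypes, §4 Thm. 4.1 and Thm. 4.6] -/
theorem cmToAbelian_iff_modCM_spanLifting_and_qbarSpreading_of_qbarFibreDescent (𝔇 : RealizationFamily)
    (hJ : CMAbelianHodge → SpecialisationsAlgebraicAV 𝔇) (hVo : voisin2007_flatSpread_of_isAbsoluteHodgeClass)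
    (hD : deligne_globalInvariantCycles) (hDel : deligne1982_hodgeClasses_abelianVariety_absoluteHodge)
    (hCat : catanese2002_abelianFibres_of_abelianFibre) (hDesc : QbarFibreDescent) :
    CMToAbelian ↔ ModCM (SpanLiftingAtAlmostAllPrimesAV 𝔇 ∧ QbarSpreading) :=
  cmToAbelian_iff_modCM_spanLifting_and_qbarSpreading 𝔇 hJ
    (qbarHodgeFamilies_of_flatSpread_of_qbarFibreDescent hVo hD hDel hCat hDesc)

end Summit.HodgeConjecture.HodgeConjecture.Ring2.Deform
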